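import Literature.Computability.FineGrained.IPRenameVector
import HarnessLib

/-!
# The renaming machine of Impagliazzo–Paturi's Lemma 2, XIX: the loop over the f-vectors; one mask

Family `fine-grained` (trunk T-CPLX-FINE). Nineteenth file of the machine half of
Impagliazzo–Paturi, *On the complexity of k-SAT*, JCSS 62 (2001), Lemma 2 (the named fact
`ipRename_reduceList_computable` of `IPLemma2Assembly.lean`). For one mask `bs` of the colours
(`IPRename.reduceList` ranges over `tuples (numCols k cap)`), the disjuncts are the reduced
formulas `reduce ⟨cap, len, maskOf bs, fv⟩ φ` over the `f`-vectors dominated by the sizes of the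
nonempty blocks with `t ≤ Σ fv` (`reduceList_eq_numNB`, `IPRenameTables.lean`). The machine
enumerates these vectors with the odometer of `IPRenameOdometer.lean` and emits each disjunct
with `vecStep` (`IPRenameVector.lean`).

* `vecBody m` / `vecLoop m` — the `whileLoop` (`IPRenameLoops.lean`) over the `odoM ss` vectors
  `odoAt ss i` (`vecStep`, `fvStep`, re-arm unless the odometer overflowed), **`runs_vecLoop`**
  (the accumulator receives `(accW … (odoM ss))ʳ`, the `f`-vector register ends on the overflow
  value, everything else is restored) and **`accW_eq_encodeList`**: the words emitted for a mask
  are `KCNF.encodeList` of the corresponding segment of `reduceList` (`map_odoAt_reverse`,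
  `vecW_eq`);
* `initFv` (the zero vector: one comma per digit of the size word), `maskStep bs m` (dictionary,
  annotated clauses, block table and sizes — `IPRenameDict/Annot/BTable.lean` —, the zero
  vector, the loop, clean-up) with its base hypotheses `MBase` (occurrence table, clauses, `n`,
  `t`; everything else empty) and **`runs_maskStep`**; the size word of `btBuild` is the digit
  word of the reversed nonempty block sizes (`szW_eq_dW`).

## References

* R. Impagliazzo, R. Paturi, *On the complexity of k-SAT*, J. Comput. System Sci. 62 (2001)
  367–375, doi:10.1006/jcss.2000.1727, Lemma 2 (p. 373) and its "Moreover" sentence, p. 372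
  ("Φ = ⋁_f Φ_f where f ranges over all vectors … such that Σ f_i ≥ …"); conference version:
  *Complexity of k-SAT*, Proc. 14th IEEE CCC (1999), doi:10.1109/ccc.1999.766282, Theorem 2 (p. 4).
* T. Nipkow, G. Klein, *Concrete Semantics with Isabelle/HOL*, Springer 2014, Ch. 7 (big-step
  reasoning about loops, as in `SymbolPrograms.lean`).
-/

namespace Literature.Computability.FineGrained.IPRenameM

open _root_.Computability Complexity Complexity.ACom Sparsifier IPRename
open Compaction (uflag uflag_true uflag_false)

/-! ### Parameters with a given `f`-vector -/

/-- The parameters of the reduction for a mask, with a given `f`-vector (block order). [folklore] -/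
abbrev Pof (cap len : ℕ) (mask : ℕ → Bool) (fvB : List ℕ) : Params := ⟨cap, len, mask, fvB⟩

/-- The `f`-vector component. [folklore] -/
@[simp] theorem Pof_fv (cap len : ℕ) (mask : ℕ → Bool) (fvB : List ℕ) : (Pof cap len mask fvB).fv = fvB := rfl

/-- `VBase` does not depend on the `f`-vector component of the parameters (the annotated clauses,
the block table and the `A`-count do not read it). [folklore] -/
theorem VBase.pof {T : AStore Γ' KR} {cap len : ℕ} {mask : ℕ → Bool} {fvB : List ℕ} {F : List (List (ℕ × Bool))} {n t : ℕ} {ss ds : List ℕ}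
    (h : VBase T (Pof cap len mask fvB) F n t ss ds) (fvB' : List ℕ) : VBase T (Pof cap len mask fvB') F n t ss ds :=
  { ac := h.ac, bt := h.bt, szs := h.szs, fv := h.fv, na := h.na, nun := h.nun, thr := h.thr, vw := h.vw, fnd := h.fnd, ex := h.ex, eb := h.eb, lmd := h.lmd, ne := h.ne, x2 := h.x2, t1 := h.t1, t2 := h.t2, btw := h.btw, md2 := h.md2, pt := h.pt, pf := h.pf, lpol := h.lpol, allf := h.allf, ft := h.ft, ff := h.ff, gt := h.gt, gf := h.gf, done := h.done, ru := h.ru, cntf := h.cntf, ytw := h.ytw, yv := h.yv, clw := h.clw, md := h.md, pol := h.pol, tag := h.tag, pr := h.pr, blk := h.blk, iu2 := h.iu2, pos := h.pos, res := h.res, val := h.val, cl := h.cl, c2 := h.c2, u1 := h.u1, fl2 := h.fl2, fl3 := h.fl3, iu := h.iu, s0 := h.s0, ac2 := h.ac2, s7 := h.s7, s1 := h.s1, s3 := h.s3, u2 := h.u2, cnt := h.cnt, ycnt := h.ycnt, s6 := h.s6, fl := h.fl, fv2 := h.fv2, szs2 := h.szs2, yt := h.yt, u3 := h.u3, ju :=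 h.ju, hd2 := h.hd2, s4 := h.s4 }


/-! ### The loop over the `f`-vectors: programs and functional description -/

/-- One vector: the disjunct (if the threshold test succeeds), the odometer step, and re-arming
the loop unless the odometer overflowed. [folklore] -/
def vecBody (m : ℕ) : RProg :=
  vecStep m ;; fvStep m ;; pop (kr KR.ju) fun o => match o with
    | some _ => skip
    | none => push (kr KR.s4) Γ'.blank

/-- **The loop over the `f`-vectors** of the current mask. [folklore] -/
def vecLoop (m : ℕ) : RProg := push (kr KR.s4) Γ'.blank ;; whileLoop (kr KR.s4) (vecBody m)

section VecLoopDefs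

variable (cap len : ℕ) (mask : ℕ → Bool) (F : List (List (ℕ × Bool))) (n t m Y : ℕ) (ss : List ℕ)

/-- The word emitted for the `i`-th vector of the odometer (empty if the threshold test fails).
[folklore] -/
def emitW (i : ℕ) : List Γ' :=
  if t ≤ (odoAt ss i).sum then vecW (Pof cap len mask (odoAt ss i).reverse) F n (odoAt ss i) else []

/-- The words emitted for the first `i` vectors, in order. [folklore] -/
def accW (i : ℕ) : List Γ' := (List.range i).flatMap (emitW cap len mask F n t ss)

/-- The content of the `f`-vector register before iteration `i` (the overflow value at the end).
[folklore] -/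
def vecAt (i : ℕ) : List ℕ := if i < odoM ss then odoAt ss i else (succD ss ss).1

/-- The cost of iteration `i`. [folklore] -/
def vecBodyCost (i : ℕ) : ℕ :=
  vecStepCost (Pof cap len mask (odoAt ss i).reverse) F m n t Y (odoAt ss i) ss + fvStepCost m ss.length + 3

/-- The cost of the loop: a uniform bound per iteration (the largest one), `odoM ss` iterations.
[folklore] -/
def vecLoopCost : ℕ := ((Finset.range (odoM ss)).sup (vecBodyCost cap len mask F n t m Y ss) + 2) * odoM ss + 2

/-- The store before iteration `i`: the emitted words reversed on the accumulator, the current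
vector in `fv`. [folklore] -/
def lS (acc₀ : List Γ') (T : AStore Γ' KR) (i : ℕ) : RStore :=
  vS ((accW cap len mask F n t ss i).reverse ++ acc₀) (Function.update T KR.fv (dW (vecAt ss i)))

/-- `accW` of a successor. [folklore] -/
theorem accW_succ (i : ℕ) : accW cap len mask F n t ss (i + 1) = accW cap len mask F n t ss i ++ emitW cap len mask F n t ss i := by
  simp [accW, List.range_succ, List.flatMap_append]

end VecLoopDefs

/-! ### The loop over the `f`-vectors: specifications -/

section VecLoopSpec

variable {cap len : ℕ} {mask : ℕ → Bool} {F : List (List (ℕ × Bool))} {n t m Y : ℕ} {ss : List ℕ} {T : AStore Γ' KR}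
  (hV : VBase T (Pof cap len mask []) F n t ss (odoAt ss 0)) (hss : ss = (sizesNB (Pof cap len mask []) F).reverse)
  (hm : ∀ s ∈ ss, s ≤ m) (hY : (aList (Pof cap len mask []) F).length + ss.sum ≤ Y) (acc₀ : List Γ')
include hV hss hm hY

/-- **One iteration.** [folklore] -/
theorem runs_vecBody (i : ℕ) (hi : i < odoM ss) :
    Runs (vecBody m) (lS cap len mask F n t ss acc₀ T i)
      (Function.update (lS cap len mask F n t ss acc₀ T (i + 1)) (kr KR.s4) (if i + 1 < odoM ss then [Γ'.blank] else []))
      (vecBodyCost cap len mask F n t m Y ss i) := by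
  set ds := odoAt ss i with hds
  have hdom : List.Forall₂ (· ≤ ·) ds ss := odoAt_le ss i
  have hlen : ds.length = ss.length := hdom.length_eq
  have hVi : VBase (Function.update T KR.fv (dW ds)) (Pof cap len mask ds.reverse) F n t ss ds := (hV.upd_fv ds).pof _
  have e0 : lS cap len mask F n t ss acc₀ T i = vS ((accW cap len mask F n t ss i).reverse ++ acc₀) (Function.update T KR.fv (dW ds)) := by
    rw [lS, vecAt, if_pos hi]
  rw [e0]
  unfold vecBody
  -- 1. the disjunct
  have h1 := runs_vecStep hVi rfl hss hdom hm Y hY ((accW cap len mask F n t ss i).reverse ++ acc₀)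
  set acc' := (if t ≤ ds.sum then (vecW (Pof cap len mask ds.reverse) F n ds).reverse else []) ++ ((accW cap len mask F n t ss i).reverse ++ acc₀) with hacc'
  have eacc : acc' = (accW cap len mask F n t ss (i + 1)).reverse ++ acc₀ := by
    rw [hacc', accW_succ, List.reverse_append, emitW, ← hds, List.append_assoc]
    split_ifs <;> simp
  -- 2. the odometer step
  have h2 := runs_fvStep (vS acc' (Function.update T KR.fv (dW ds))) m (by simp [hV.t1]) (by simp [hV.t2]) ds ss hdom hm
    (by simp [hV.szs]) (by simp) (by simp [hV.szs2]) (by simp [hV.u1]) (by simp [hV.u2]) (by simp [hV.u3]) (by simp [hV.fl2])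
    (by simp [hV.fl3]) (by simp [hV.fv2]) (by simp [hV.fl]) (by simp [hV.ju])
  rw [update_vS_kr, update_vS_kr, Function.update_idem] at h2
  have eju : ∀ v : List Γ', Function.update (Function.update T KR.fv v) KR.ju [] = Function.update T KR.fv v := fun v =>
    Function.update_eq_self_iff.2 (by rw [Function.update_of_ne (by decide)]; exact hV.ju.symm)
  -- 3. re-arm or stop
  by_cases hnext : i + 1 < odoM ss
  · rw [succD_odoAt ss i hnext] at h2
    simp only [uflag_false] at h2
    have h3 : Runs (pop (kr KR.ju) fun o => match o with
        | some _ => skip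
        | none => push (kr KR.s4) Γ'.blank)
        (vS acc' (Function.update (Function.update T KR.fv (dW (odoAt ss (i + 1)))) KR.ju []))
        (Function.update (lS cap len mask F n t ss acc₀ T (i + 1)) (kr KR.s4) [Γ'.blank]) (1 + 2) := by
      refine Runs.pop_nil (by simp) (Runs.push' ?_)
      rw [eju, lS, vecAt, if_pos hnext, eacc]
      simp [hV.s4]
    refine (h1.seq (h2.seq h3)).of_eq ?_ ?_
    · rw [if_pos hnext]
    · unfold vecBodyCost; rw [← hds, hlen]; omega
  · have hiN : i = odoM ss - 1 := by omega
    have hlast : odoAt ss i = ss := by rw [hiN]; exact odoAt_last ss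
    rw [hds, hlast, succD_last, uflag_true] at h2
    have h3 : Runs (pop (kr KR.ju) fun o => match o with
        | some _ => skip
        | none => push (kr KR.s4) Γ'.blank)
        (vS acc' (Function.update (Function.update T KR.fv (dW (succD ss ss).1)) KR.ju [Γ'.blank]))
        (Function.update (lS cap len mask F n t ss acc₀ T (i + 1)) (kr KR.s4) []) (0 + 2) := by
      refine Runs.pop_cons (k := kr KR.ju) (a := Γ'.blank) (w := []) (by simp) ((Runs.skip _).of_eq ?_ le_rfl)
      rw [update_vS_kr, Function.update_idem, eju, lS, vecAt, if_neg hnext, eacc, update_vS_kr]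
      congr 1
      exact (Function.update_eq_self_iff.2 (by rw [Function.update_of_ne (by decide)]; exact hV.s4.symm)).symm
    rw [hds, hlast] at h1 ⊢
    refine (h1.seq (h2.seq h3)).of_eq ?_ ?_
    · rw [if_neg hnext]
    · unfold vecBodyCost; rw [hlast]; omega

/-- **The loop over the `f`-vectors.** Started on the zero vector (armed), it ends after `odoM ss`
iterations with all emitted words reversed on the accumulator. [folklore] -/
theorem runs_vecLoop :
    Runs (vecLoop m) (vS acc₀ T) (lS cap len mask F n t ss acc₀ T (odoM ss)) (vecLoopCost cap len mask F n t m Y ss) := by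
  have hN := odoM_pos ss
  have e0 : lS cap len mask F n t ss acc₀ T 0 = vS acc₀ T := by
    rw [lS, vecAt, if_pos hN]
    simp only [accW, List.range_zero, List.flatMap_nil, List.reverse_nil, List.nil_append]
    congr 1
    exact Function.update_eq_self_iff.2 hV.fv.symm
  unfold vecLoop
  have h0 : Runs (push (kr KR.s4) Γ'.blank) (vS acc₀ T) (Function.update (lS cap len mask F n t ss acc₀ T 0) (kr KR.s4) [Γ'.blank]) 1 :=
    Runs.push' (by rw [e0]; simp [hV.s4])
  have hgo : ∀ i, lS cap len mask F n t ss acc₀ T i (kr KR.s4) = [] := fun i => by simp [lS, hV.s4]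
  have h1 := runs_whileLoop (kr KR.s4) Γ'.blank (vecBody m) (lS cap len mask F n t ss acc₀ T) (odoM ss)
    ((Finset.range (odoM ss)).sup (vecBodyCost cap len mask F n t m Y ss)) hN hgo
    (fun i hi => (runs_vecBody hV hss hm hY acc₀ i hi).mono (Finset.le_sup (f := vecBodyCost cap len mask F n t m Y ss) (Finset.mem_range.2 hi)))
  refine (h0.seq h1).of_eq rfl ?_
  unfold vecLoopCost; omega

end VecLoopSpec

/-! ### The words emitted for a mask are a segment of `reduceList` -/

/-- **The words emitted for a mask**: the encodings of the disjuncts `reduce ⟨cap, len, mask, fv⟩ φ`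
over the dominated `f`-vectors with `t ≤ Σ fv`, in the order of `fvecs`. [folklore] -/
theorem accW_eq_encodeList {k : ℕ} (φ : KCNF k) (cap len : ℕ) (mask : ℕ → Bool) (t : ℕ) {ss : List ℕ}
    (hss : ss = (sizesNB (Pof cap len mask []) φ.clauses).reverse) :
    accW cap len mask φ.clauses φ.numVars t ss (odoM ss) =
      KCNF.encodeList (k := kOut k cap len) (((fvecs (sizesNB (Pof cap len mask []) φ.clauses)).filter fun fv => decide (t ≤ fv.sum)).map
        fun fv => (reduce ⟨cap, len, mask, fv⟩ φ : KCNF (kOut k cap len))) := by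
  have e1 : sizesNB (Pof cap len mask []) φ.clauses = ss.reverse := by rw [hss, List.reverse_reverse]
  set g : List ℕ → List Γ' := fun v => if t ≤ v.sum then (reduce ⟨cap, len, mask, v⟩ φ : KCNF (kOut k cap len)).encode ++ [Γ'.blank] else [] with hg
  have step : ∀ i, emitW cap len mask φ.clauses φ.numVars t ss i = g (odoAt ss i).reverse := by
    intro i
    simp only [hg, emitW, List.sum_reverse]
    split_ifs with h
    · exact vecW_eq φ (Pof cap len mask (odoAt ss i).reverse) rfl hss (odoAt_le ss i)
    · rfl
  have key : ∀ l : List (List ℕ), l.flatMap g =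
      KCNF.encodeList (k := kOut k cap len) ((l.filter fun fv => decide (t ≤ fv.sum)).map
        fun fv => (reduce ⟨cap, len, mask, fv⟩ φ : KCNF (kOut k cap len))) := by
    intro l
    induction l with
    | nil => rfl
    | cons v l ih =>
      rw [List.flatMap_cons, ih, List.filter_cons]
      by_cases hv : t ≤ v.sum <;> simp [hg, hv, KCNF.encodeList]
  unfold accW
  calc (List.range (odoM ss)).flatMap (emitW cap len mask φ.clauses φ.numVars t ss)
      = (List.range (odoM ss)).flatMap (fun i => g (odoAt ss i).reverse) := by
          refine List.flatMap_congr fun i _ => step i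
    _ = ((List.range (odoM ss)).map fun i => (odoAt ss i).reverse).flatMap g := by rw [List.flatMap_map]
    _ = (fvecs ss.reverse).flatMap g := by rw [map_odoAt_reverse]
    _ = _ := by rw [← e1]; exact key _

/-! ### The zero vector -/

/-- Count the digits (commas) of `src` (consumed) as commas onto `dst`. [folklore] -/
def tallyC (src dst : Reg) : RProg := loop src fun s => match s with
  | Γ'.comma => push dst Γ'.comma
  | _ => skip

/-- **`tallyC`.** [folklore] -/
theorem runs_tallyC {src dst : Reg} (hsd : src ≠ dst) : ∀ (u : List Γ') (R : RStore), R src = u →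
    Runs (tallyC src dst) R (Function.update (Function.update R src []) dst (List.replicate (u.count Γ'.comma) Γ'.comma ++ R dst)) (3 * u.length + 1)
  | [], R, h => by
    refine (Runs.loop_nil _ h).of_eq ?_ (by simp)
    rw [List.count_nil, List.replicate_zero, List.nil_append, Function.update_eq_self_iff.2 (by simp [hsd.symm]), Function.update_eq_self_iff.2 h.symm]
  | s :: u, R, h => by
    have hb : Runs (match s with
        | Γ'.comma => push dst Γ'.comma
        | _ => skip) (Function.update R src u) (Function.update (Function.update R src u) dst ((if s = Γ'.comma then [Γ'.comma] else []) ++ R dst)) 1 := by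
      cases s with
      | comma => exact Runs.push' (by simp [hsd.symm])
      | _ => exact (Runs.skip _).of_eq (by simp [hsd.symm]) (by norm_num)
    have ih := runs_tallyC hsd u (Function.update (Function.update R src u) dst ((if s = Γ'.comma then [Γ'.comma] else []) ++ R dst)) (by simp [hsd])
    unfold tallyC at ih ⊢
    refine (Runs.loop_cons (f := fun s => match s with
        | Γ'.comma => push dst Γ'.comma
        | _ => skip) h hb ih).of_eq ?_ (show 1 + 2 + (3 * u.length + 1) ≤ 3 * (s :: u).length + 1 by simp; omega)
    funext q
    by_cases q1 : q = dst
    · subst q1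
      simp only [Function.update_self, List.count_cons]
      cases s <;> simp [List.replicate_succ', List.append_assoc]
    by_cases q2 : q = src; · subst q2; simp [hsd]
    simp [q1, q2]

/-- The digits of a digit word are counted by its commas. [folklore] -/
theorem count_comma_dW : ∀ ds : List ℕ, (dW ds).count Γ'.comma = ds.length
  | [] => rfl
  | d :: ds => by rw [dW_cons, List.count_append, List.count_cons, count_comma_dW ds]; simp [List.count_replicate]

/-- The word of the zero vector. [folklore] -/
theorem dW_replicate_zero : ∀ j : ℕ, dW (List.replicate j 0) = List.replicate j Γ'.comma
  | 0 => rfl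
  | j + 1 => by rw [List.replicate_succ, dW_cons, dW_replicate_zero j]; rfl

/-- The overflow value of the odometer is the zero vector. [folklore] -/
theorem succD_self : ∀ ss : List ℕ, (succD ss ss).1 = List.replicate ss.length 0
  | [] => rfl
  | s :: ss => by rw [succD, if_neg (lt_irrefl s), succD_self ss]; rfl

/-- `initFv`: write the zero vector — one comma per digit of the size word — into `fv`. [folklore] -/
def initFv : RProg := copyToG (kr KR.szs) (kr KR.szs2) (kr KR.t1) (kr KR.t2) ;; tallyC (kr KR.szs2) (kr KR.fv)

/-- **`initFv`.** [folklore] -/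
theorem runs_initFv (R : RStore) (ss : List ℕ) (hszs : R (kr KR.szs) = dW ss) (hszs2 : R (kr KR.szs2) = []) (ht1 : R (kr KR.t1) = [])
    (ht2 : R (kr KR.t2) = []) (hfv : R (kr KR.fv) = []) :
    Runs initFv R (Function.update R (kr KR.fv) (dW (odoAt ss 0))) (13 * (dW ss).length + 4) := by
  unfold initFv
  have h1 := runs_copyToG (a := kr KR.szs) (b := kr KR.szs2) (t₁ := kr KR.t1) (t₂ := kr KR.t2) (by simp) (by simp) (by simp) (by simp) (by simp) (by simp) R ht1 ht2 hszs2
  rw [hszs] at h1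
  have h2 := runs_tallyC (src := kr KR.szs2) (dst := kr KR.fv) (by simp) (dW ss) (Function.update R (kr KR.szs2) (dW ss)) (by simp)
  have e2 : Function.update R (kr KR.szs2) [] = R := Function.update_eq_self_iff.2 hszs2.symm
  rw [Function.update_idem, Function.update_of_ne (by simp), hfv, List.append_nil, count_comma_dW, e2] at h2
  refine (h1.seq h2).of_eq ?_ (by omega)
  rw [odoAt_zero, dW_replicate_zero]

/-! ### The temporaries of the mask level -/

/-- The store family `mS` over a base store: the temporaries of this level. [folklore] -/
def mS (S : RStore) (na dict ac szs bt fv : List Γ') : RStore := fun r =>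
  if r = kr KR.na then na else if r = kr KR.dict then dict else if r = kr KR.ac then ac else if r = kr KR.szs then szs else if r = kr KR.bt then bt else if r = kr KR.fv then fv else S r

section MsLemmas

variable (S : RStore) (na dict ac szs bt fv w : List Γ')

/-- Reading `na`. [folklore] -/
@[simp] theorem mS_na : mS S na dict ac szs bt fv (kr KR.na) = na := by simp [mS]
/-- Reading `dict`. [folklore] -/
@[simp] theorem mS_dict : mS S na dict ac szs bt fv (kr KR.dict) = dict := by simp [mS]
/-- Reading `ac`. [folklore] -/
@[simp] theorem mS_ac : mS S na dict ac szs bt fv (kr KR.ac) = ac := by simp [mS]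
/-- Reading `szs`. [folklore] -/
@[simp] theorem mS_szs : mS S na dict ac szs bt fv (kr KR.szs) = szs := by simp [mS]
/-- Reading `bt`. [folklore] -/
@[simp] theorem mS_bt : mS S na dict ac szs bt fv (kr KR.bt) = bt := by simp [mS]
/-- Reading `fv`. [folklore] -/
@[simp] theorem mS_fv : mS S na dict ac szs bt fv (kr KR.fv) = fv := by simp [mS]
/-- Reading any other register. [folklore] -/
theorem mS_other {r : Reg} (h0 : r ≠ kr KR.na) (h1 : r ≠ kr KR.dict) (h2 : r ≠ kr KR.ac) (h3 : r ≠ kr KR.szs) (h4 : r ≠ kr KR.bt) (h5 : r ≠ kr KR.fv) :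
    mS S na dict ac szs bt fv r = S r := by simp [mS, h0, h1, h2, h3, h4, h5]
/-- Reading `fam`. [folklore] -/
@[simp] theorem mS_fam : mS S na dict ac szs bt fv (kr KR.fam) = S (kr KR.fam) := by simp [mS]
/-- Reading `oc`. [folklore] -/
@[simp] theorem mS_oc : mS S na dict ac szs bt fv (kr KR.oc) = S (kr KR.oc) := by simp [mS]
/-- Reading `nun`. [folklore] -/
@[simp] theorem mS_nun : mS S na dict ac szs bt fv (kr KR.nun) = S (kr KR.nun) := by simp [mS]
/-- Reading `thr`. [folklore] -/
@[simp] theorem mS_thr : mS S na dict ac szs bt fv (kr KR.thr) = S (kr KR.thr) := by simp [mS]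
/-- Reading `t1`. [folklore] -/
@[simp] theorem mS_t1 : mS S na dict ac szs bt fv (kr KR.t1) = S (kr KR.t1) := by simp [mS]
/-- Reading `t2`. [folklore] -/
@[simp] theorem mS_t2 : mS S na dict ac szs bt fv (kr KR.t2) = S (kr KR.t2) := by simp [mS]
/-- Reading `acc` of the emission bank. [folklore] -/
@[simp] theorem mS_tb_acc : mS S na dict ac szs bt fv (tb TB.acc) = S (tb TB.acc) := by simp [mS]
/-- Updating `na`. [folklore] -/
@[simp] theorem update_mS_na : Function.update (mS S na dict ac szs bt fv) (kr KR.na) w = mS S w dict ac szs bt fv := by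
  funext r; by_cases h : r = kr KR.na
  · subst h; simp
  · rw [Function.update_of_ne h]; simp [mS, h]
/-- Updating `dict`. [folklore] -/
@[simp] theorem update_mS_dict : Function.update (mS S na dict ac szs bt fv) (kr KR.dict) w = mS S na w ac szs bt fv := by
  funext r; by_cases h : r = kr KR.dict
  · subst h; simp
  · rw [Function.update_of_ne h]; simp [mS, h]
/-- Updating `ac`. [folklore] -/
@[simp] theorem update_mS_ac : Function.update (mS S na dict ac szs bt fv) (kr KR.ac) w = mS S na dict w szs bt fv := by
  funext r; by_cases h : r = kr KR.ac
  · subst h; simp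
  · rw [Function.update_of_ne h]; simp [mS, h]
/-- Updating `szs`. [folklore] -/
@[simp] theorem update_mS_szs : Function.update (mS S na dict ac szs bt fv) (kr KR.szs) w = mS S na dict ac w bt fv := by
  funext r; by_cases h : r = kr KR.szs
  · subst h; simp
  · rw [Function.update_of_ne h]; simp [mS, h]
/-- Updating `bt`. [folklore] -/
@[simp] theorem update_mS_bt : Function.update (mS S na dict ac szs bt fv) (kr KR.bt) w = mS S na dict ac szs w fv := by
  funext r; by_cases h : r = kr KR.bt
  · subst h; simp
  · rw [Function.update_of_ne h]; simp [mS, h]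
/-- Updating `fv`. [folklore] -/
@[simp] theorem update_mS_fv : Function.update (mS S na dict ac szs bt fv) (kr KR.fv) w = mS S na dict ac szs bt w := by
  funext r; by_cases h : r = kr KR.fv
  · subst h; simp
  · rw [Function.update_of_ne h]; simp [mS, h]

end MsLemmas

/-- Every store is a `mS` over itself. [folklore] -/
theorem mS_eta (R : RStore) : mS R (R (kr KR.na)) (R (kr KR.dict)) (R (kr KR.ac)) (R (kr KR.szs)) (R (kr KR.bt)) (R (kr KR.fv)) = R := by
  funext r
  by_cases h0 : r = kr KR.na; · subst h0; simp
  by_cases h1 : r = kr KR.dict; · subst h1; simp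
  by_cases h2 : r = kr KR.ac; · subst h2; simp
  by_cases h3 : r = kr KR.szs; · subst h3; simp
  by_cases h4 : r = kr KR.bt; · subst h4; simp
  by_cases h5 : r = kr KR.fv; · subst h5; simp
  rw [mS_other _ _ _ _ _ _ _ h0 h1 h2 h3 h4 h5]

/-- Updating a register outside the family passes to the base store. [folklore] -/
theorem update_mS_base (S : RStore) (na dict ac szs bt fv : List Γ') {x : Reg} (h0 : x ≠ kr KR.na) (h1 : x ≠ kr KR.dict) (h2 : x ≠ kr KR.ac) (h3 : x ≠ kr KR.szs) (h4 : x ≠ kr KR.bt) (h5 : x ≠ kr KR.fv) (u : List Γ') :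
    Function.update (mS S na dict ac szs bt fv) x u = mS (Function.update S x u) na dict ac szs bt fv := by
  funext r; by_cases h : r = x
  · subst h; rw [Function.update_self, mS_other _ _ _ _ _ _ _ h0 h1 h2 h3 h4 h5, Function.update_self]
  · rw [Function.update_of_ne h]
    by_cases g0 : r = kr KR.na
    · subst g0; simp
    by_cases g1 : r = kr KR.dict
    · subst g1; simp
    by_cases g2 : r = kr KR.ac
    · subst g2; simp
    by_cases g3 : r = kr KR.szs
    · subst g3; simp
    by_cases g4 : r = kr KR.bt
    · subst g4; simp
    by_cases g5 : r = kr KR.fv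
    · subst g5; simp
    rw [mS_other _ _ _ _ _ _ _ g0 g1 g2 g3 g4 g5, mS_other _ _ _ _ _ _ _ g0 g1 g2 g3 g4 g5, Function.update_of_ne h]

/-- The family store is the level store over the updated work registers. [folklore] -/
theorem mS_vS (acc : List Γ') (T : AStore Γ' KR) (na dict ac szs bt fv : List Γ') :
    mS (vS acc T) na dict ac szs bt fv =
      vS acc (Function.update (Function.update (Function.update (Function.update (Function.update (Function.update T KR.na na)
        KR.dict dict) KR.ac ac) KR.szs szs) KR.bt bt) KR.fv fv) := by
  funext r
  rcases r with y | x
  · cases y <;> rfl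
  · by_cases h0 : x = KR.na; · subst h0; simp
    by_cases h1 : x = KR.dict; · subst h1; simp
    by_cases h2 : x = KR.ac; · subst h2; simp
    by_cases h3 : x = KR.szs; · subst h3; simp
    by_cases h4 : x = KR.bt; · subst h4; simp
    by_cases h5 : x = KR.fv; · subst h5; simp
    simp [mS, h0, h1, h2, h3, h4, h5]

/-! ### The base hypotheses of the mask level -/

/-- What one mask needs of the work registers: the clauses, the occurrence table, `n` and the
threshold in unary; every other register used below empty. [folklore] -/
structure MBase (T : AStore Γ' KR) (cap : ℕ) (F : List (List (ℕ × Bool))) (n t : ℕ) : Prop where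
  /-- data -/
  fam : T KR.fam = wFam F
  /-- data -/
  oc : T KR.oc = wRecs (ocRecs F cap (occList F))
  /-- data -/
  nun : T KR.nun = ticks Γ'.blank n
  /-- data -/
  thr : T KR.thr = ticks Γ'.blank t
  /-- empty -/
  vw : T KR.vw = []
  /-- empty -/
  fnd : T KR.fnd = []
  /-- empty -/
  ex : T KR.ex = []
  /-- empty -/
  eb : T KR.eb = []
  /-- empty -/
  lmd : T KR.lmd = []
  /-- empty -/
  ne : T KR.ne = []
  /-- empty -/
  x2 : T KR.x2 = []
  /-- empty -/
  t1 : T KR.t1 = []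
  /-- empty -/
  t2 : T KR.t2 = []
  /-- empty -/
  btw : T KR.btw = []
  /-- empty -/
  md2 : T KR.md2 = []
  /-- empty -/
  pt : T KR.pt = []
  /-- empty -/
  pf : T KR.pf = []
  /-- empty -/
  lpol : T KR.lpol = []
  /-- empty -/
  allf : T KR.allf = []
  /-- empty -/
  ft : T KR.ft = []
  /-- empty -/
  ff : T KR.ff = []
  /-- empty -/
  gt : T KR.gt = []
  /-- empty -/
  gf : T KR.gf = []
  /-- empty -/
  done : T KR.done = []
  /-- empty -/
  ru : T KR.ru = []
  /-- empty -/
  cntf : T KR.cntf = []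
  /-- empty -/
  ytw : T KR.ytw = []
  /-- empty -/
  yv : T KR.yv = []
  /-- empty -/
  clw : T KR.clw = []
  /-- empty -/
  md : T KR.md = []
  /-- empty -/
  pol : T KR.pol = []
  /-- empty -/
  tag : T KR.tag = []
  /-- empty -/
  pr : T KR.pr = []
  /-- empty -/
  blk : T KR.blk = []
  /-- empty -/
  iu2 : T KR.iu2 = []
  /-- empty -/
  pos : T KR.pos = []
  /-- empty -/
  res : T KR.res = []
  /-- empty -/
  val : T KR.val = []
  /-- empty -/
  cl : T KR.cl = []
  /-- empty -/
  c2 : T KR.c2 = []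
  /-- empty -/
  u1 : T KR.u1 = []
  /-- empty -/
  fl2 : T KR.fl2 = []
  /-- empty -/
  fl3 : T KR.fl3 = []
  /-- empty -/
  iu : T KR.iu = []
  /-- empty -/
  s0 : T KR.s0 = []
  /-- empty -/
  ac2 : T KR.ac2 = []
  /-- empty -/
  s7 : T KR.s7 = []
  /-- empty -/
  s1 : T KR.s1 = []
  /-- empty -/
  s3 : T KR.s3 = []
  /-- empty -/
  u2 : T KR.u2 = []
  /-- empty -/
  cnt : T KR.cnt = []
  /-- empty -/
  ycnt : T KR.ycnt = []
  /-- empty -/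
  s6 : T KR.s6 = []
  /-- empty -/
  fl : T KR.fl = []
  /-- empty -/
  fv2 : T KR.fv2 = []
  /-- empty -/
  szs2 : T KR.szs2 = []
  /-- empty -/
  yt : T KR.yt = []
  /-- empty -/
  u3 : T KR.u3 = []
  /-- empty -/
  ju : T KR.ju = []
  /-- empty -/
  hd2 : T KR.hd2 = []
  /-- empty -/
  s4 : T KR.s4 = []
  /-- empty -/
  oc2 : T KR.oc2 = []
  /-- empty -/
  dict2 : T KR.dict2 = []
  /-- empty -/
  c : T KR.c = []
  /-- empty -/
  sat : T KR.sat = []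
  /-- empty -/
  posc : T KR.posc = []
  /-- empty -/
  fam2 : T KR.fam2 = []
  /-- empty -/
  key : T KR.key = []
  /-- empty -/
  pr2 : T KR.pr2 = []
  /-- empty -/
  s2 : T KR.s2 = []
  /-- empty -/
  s5 : T KR.s5 = []
  /-- empty -/
  dict : T KR.dict = []
  /-- empty -/
  na : T KR.na = []
  /-- empty -/
  ac : T KR.ac = []
  /-- empty -/
  bt : T KR.bt = []
  /-- empty -/
  szs : T KR.szs = []
  /-- empty -/
  fv : T KR.fv = []

/-- Once the tables of the mask and the zero vector are in place, the base hypotheses of the vector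
level hold. [folklore] -/
theorem MBase.vbase {T : AStore Γ' KR} {cap : ℕ} {F : List (List (ℕ × Bool))} {n t : ℕ} (h : MBase T cap F n t)
    (P : Params) (_hcap : P.cap = cap) (ss ds : List ℕ) (dct : List Γ') :
    VBase (Function.update (Function.update (Function.update (Function.update (Function.update (Function.update T KR.na (bitsN (aList P F).length))
      KR.dict dct) KR.ac (wAC P F)) KR.szs (dW ss)) KR.bt (wBT (btab P F))) KR.fv (dW ds)) P F n t ss ds :=
  { ac := by simp, bt := by simp, szs := by simp, fv := by simp, na := by simp, nun := by simp [h.nun], thr := by simp [h.thr], vw := by simp [h.vw], fnd := by simp [h.fnd], ex := by simp [h.ex], eb := by simp [h.eb], lmd := by simp [h.lmd], ne := by simp [h.ne], x2 := by simp [h.x2], t1 := by simp [h.t1], t2 := by simp [h.t2], btw := by simp [h.btw], md2 := by simp [h.md2], pt := by simp [h.pt], pf := by simp [h.pf], lpol := by simp [h.lpol], allf := by simp [h.allf], ft := by simp [h.ft], ff := by simp [h.ff], gt := by simp [h.gt], gf := by simp [h.gf], done := by simp [h.done], ru := by simp [h.ru], cntf := by simp [h.cntf], ytw := by simp [h.ytw],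 yv := by simp [h.yv], clw := by simp [h.clw], md := by simp [h.md], pol := by simp [h.pol], tag := by simp [h.tag], pr := by simp [h.pr], blk := by simp [h.blk], iu2 := by simp [h.iu2], pos := by simp [h.pos], res := by simp [h.res], val := by simp [h.val], cl := by simp [h.cl], c2 := by simp [h.c2], u1 := by simp [h.u1], fl2 := by simp [h.fl2], fl3 := by simp [h.fl3], iu := by simp [h.iu], s0 := by simp [h.s0], ac2 := by simp [h.ac2], s7 := by simp [h.s7], s1 := by simp [h.s1], s3 := by simp [h.s3], u2 := by simp [h.u2], cnt := by simp [h.cnt], ycnt := by simp [h.ycnt], s6 := by simp [h.s6], fl := by simp [h.fl], fv2 := by simp [h.fv2], szs2 := by simp [h.szs2], yt := by simp [h.yt], u3 := by simp [h.u3], ju := by simp [h.ju], hd2 := by simp [h.hd2], s4 := by simp [h.s4] }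


/-! ### One mask: programs, sizes, cost -/

/-- **One mask**: dictionary, annotated clauses, block table and sizes, the zero vector, the loop
over the `f`-vectors, clean-up. The mask is baked into the program. [folklore] -/
def maskStep (bs : List Bool) (m : ℕ) : RProg :=
  dictBuild bs m ;; acBuild ;; btBuild m ;; initFv ;; vecLoop m ;;
  clear (kr KR.dict) ;; clear (kr KR.na) ;; clear (kr KR.ac) ;; clear (kr KR.bt) ;; clear (kr KR.szs) ;; clear (kr KR.fv)

section MaskSizes

variable (P : Params) (F : List (List (ℕ × Bool)))

/-- The `A`-count of the dictionary pass is `|aList|`. [folklore] -/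
theorem cntA_occList : cntA P F (occList F) = (aList P F).length := rfl

/-- The nonempty block sizes are the chunk lengths of `bList`. [folklore] -/
theorem sizesNB_eq_chunks : sizesNB P F = (chunks (bsz P) (bList P F)).map List.length := by
  rw [← map_block_eq_chunks, List.map_map]; rfl

/-- The nonempty block sizes sum to `|bList|`. [folklore] -/
theorem sum_sizesNB : (sizesNB P F).sum = (bList P F).length := by
  rw [← sum_length_block P F]
  obtain ⟨j, hj⟩ : ∃ j, numBlocks P F = numNB P F + j := ⟨numBlocks P F - numNB P F, by have := numNB_le_numBlocks P F; omega⟩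
  rw [hj, List.range_add, List.map_append, List.sum_append]
  have h2 : (((List.range j).map (numNB P F + ·)).map fun i => (block P F i).length).sum = 0 := by
    refine List.sum_eq_zero fun x hx => ?_
    rw [List.map_map] at hx
    obtain ⟨i, -, rfl⟩ := List.mem_map.1 hx
    simp only [Function.comp_apply]
    rw [block_eq_nil_of_numNB_le P F (by omega)]; rfl
  rw [h2, Nat.add_zero]; rfl

/-- The nonempty block sizes are at most the block length. [folklore] -/
theorem le_bsz_of_mem_sizesNB {s : ℕ} (hs : s ∈ sizesNB P F) : s ≤ bsz P := by
  obtain ⟨i, -, rfl⟩ := List.mem_map.1 hs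
  exact length_block_le P F i

/-- **The size word of `btBuild` is the digit word of the reversed nonempty block sizes.** [folklore] -/
theorem szW_eq_dW : szW (bsz P) (bList P F).length = dW (sizesNB P F).reverse := by
  rw [szW_eq_chunks P (bList P F), sizesNB_eq_chunks, dW, List.flatMap_def, List.map_reverse, List.map_map]
  rfl

end MaskSizes

/-- The machine-order sizes of a mask. [folklore] -/
def ssOf (cap len : ℕ) (mask : ℕ → Bool) (F : List (List (ℕ × Bool))) : List ℕ := (sizesNB (Pof cap len mask []) F).reverse

/-- The cost of one mask (`Lo` bounding the occurrence table, `Y` the number of occurring variables,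
`nb` the number of colours). [folklore] -/
def maskCost (cap len : ℕ) (mask : ℕ → Bool) (F : List (List (ℕ × Bool))) (n t Y Lo nb : ℕ) : ℕ :=
  dictCost Lo (bsz (Pof cap len mask [])) nb +
  ((aK Lo (wRecs (dictRecs (Pof cap len mask []) F (occList F))).length (bsz (Pof cap len mask [])) + 10) * (wFam F).length +
    3 * (wAC (Pof cap len mask []) F).length + 5) +
  btCost Lo (wRecs (dictRecs (Pof cap len mask []) F (occList F))).length (bsz (Pof cap len mask [])) (wFam F).length +
  (13 * (dW (ssOf cap len mask F)).length + 4) +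
  vecLoopCost cap len mask F n t (bsz (Pof cap len mask [])) Y (ssOf cap len mask F) +
  ((2 * (wRecs (dictRecs (Pof cap len mask []) F (occList F))).length + 1) + (2 * (bitsN (aList (Pof cap len mask []) F).length).length + 1) +
    (2 * (wAC (Pof cap len mask []) F).length + 1) + (2 * (wBT (btab (Pof cap len mask []) F)).length + 1) +
    (2 * (dW (ssOf cap len mask F)).length + 1) + (2 * (ssOf cap len mask F).length + 1))

/-- With the temporaries empty, the family store is the level store. [folklore] -/
theorem MBase.mS_vS0 {T : AStore Γ' KR} {cap : ℕ} {F : List (List (ℕ × Bool))} {n t : ℕ} (hM : MBase T cap F n t) (acc : List Γ') :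
    mS (vS acc T) [] [] [] [] [] [] = vS acc T := by
  have e := mS_eta (vS acc T)
  simp only [vS_kr, hM.na, hM.dict, hM.ac, hM.szs, hM.bt, hM.fv] at e
  exact e

section MaskSpec

variable {T : AStore Γ' KR} {cap : ℕ} {F : List (List (ℕ × Bool))} {n t : ℕ} (hM : MBase T cap F n t)
  (Lo Y : ℕ) (hLo : (wRecs (ocRecs F cap (occList F))).length ≤ Lo) (hY : (occVars F).card ≤ Y)
include hM hLo hY

/-- **One mask.** The words of its disjuncts are pushed, reversed, onto the accumulator; every
other register is restored. [folklore] -/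
theorem runs_maskStep (len : ℕ) (bs : List Bool) (acc : List Γ') :
    Runs (maskStep bs (bsz (Pof cap len (maskOf bs) []))) (vS acc T)
      (vS ((accW cap len (maskOf bs) F n t (ssOf cap len (maskOf bs) F) (odoM (ssOf cap len (maskOf bs) F))).reverse ++ acc) T)
      (maskCost cap len (maskOf bs) F n t Y Lo bs.length) := by
  set P := Pof cap len (maskOf bs) [] with hP
  set m := bsz P with hm
  set ss := ssOf cap len (maskOf bs) F with hss
  have hssP : ss = (sizesNB P F).reverse := rfl
  have hcap : P.cap = cap := rfl
  rw [← hM.mS_vS0 acc]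
  unfold maskStep
  -- 1. the dictionary
  have h1 := runs_dictBuild (mS (vS acc T) [] [] [] [] [] []) P F bs rfl (by simp [hM.t1]) (by simp [hM.t2]) (by simp [mS, hM.fl2]) (by simp [mS, hM.s7])
    Lo hLo (by simp [hM.oc, hcap]) (by simp [mS, hM.oc2]) (by simp [mS, hM.md]) (by simp [mS, hM.dict2]) (by simp [mS, hM.fl]) (by simp [mS, hM.c])
    (by simp [mS, hM.u3]) (by simp) (by simp [mS, hM.sat]) (by simp [mS, hM.posc]) (by simp [mS, hM.s6]) (by simp)
  rw [update_mS_na, update_mS_dict, cntA_occList] at h1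
  set NA := bitsN (aList P F).length with hNA
  set D := wRecs (dictRecs P F (occList F)) with hD
  -- 2. the annotated clauses
  have hA : AcBase (mS (vS acc T) NA D [] [] [] []) P F :=
    { dict := by simp [hD], fam := by simp [hM.fam], t1 := by simp [hM.t1], t2 := by simp [hM.t2], x2 := by simp [mS, hM.x2], vw := by simp [mS, hM.vw], ex := by simp [mS, hM.ex], eb := by simp [mS, hM.eb], lmd := by simp [mS, hM.lmd], ne := by simp [mS, hM.ne], dict2 := by simp [mS, hM.dict2] }
  have h2 := runs_acBuild (mS (vS acc T) NA D [] [] [] []) P F hA Lo hLo (by simp [mS, hM.fam2]) (by simp [mS, hM.md]) (by simp [mS, hM.pr])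
    (by simp [mS, hM.ac2]) (by simp [mS, hM.fnd]) (by simp [mS, hM.key]) (by simp)
  rw [update_mS_ac] at h2
  -- 3. the block table and the sizes
  have hB : BtBase (mS (vS acc T) NA D (wAC P F) [] [] []) P F :=
    { dict := by simp [hD], fam := by simp [hM.fam], t1 := by simp [hM.t1], t2 := by simp [hM.t2], x2 := by simp [mS, hM.x2], vw := by simp [mS, hM.vw], eb := by simp [mS, hM.eb], lmd := by simp [mS, hM.lmd], dict2 := by simp [mS, hM.dict2], s1 := by simp [mS, hM.s1], ex := by simp [mS, hM.ex], ju := by simp [mS, hM.ju], lpol := by simp [mS, hM.lpol], fl := by simp [mS, hM.fl], ft := by simp [mS, hM.ft], ff := by simp [mS, hM.ff], s2 := by simp [mS, hM.s2], ne := by simp [mS, hM.ne], fnd := by simp [mS, hM.fnd], key := by simp [mS, hM.key] }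
  have h3 := runs_btBuild (mS (vS acc T) NA D (wAC P F) [] [] []) P F hB Lo hLo (by simp [mS, hM.s3]) (by simp [mS, hM.md]) (by simp [mS, hM.pr])
    (by simp [mS, hM.s5]) (by simp [mS, hM.posc]) (by simp) (by simp [mS, hM.pr2]) (by simp [mS, hM.s6]) (by simp)
  rw [update_mS_szs, update_mS_bt, szW_eq_dW, btOut_eq, ← hssP] at h3
  -- 4. the zero vector
  have h4 := runs_initFv (mS (vS acc T) NA D (wAC P F) (dW ss) (wBT (btab P F)) []) ss (by simp) (by simp [mS, hM.szs2]) (by simp [hM.t1]) (by simp [hM.t2]) (by simp)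
  rw [update_mS_fv] at h4
  -- 5. the loop over the `f`-vectors
  have hV : VBase _ P F n t ss (odoAt ss 0) := hM.vbase P hcap ss (odoAt ss 0) D
  have hmss : ∀ s ∈ ss, s ≤ m := fun s hs => le_bsz_of_mem_sizesNB P F (List.mem_reverse.1 hs)
  have hYss : (aList P F).length + ss.sum ≤ Y := by
    rw [hssP, List.sum_reverse, sum_sizesNB, length_aList_add_length_bList]; exact hY
  have h5 := runs_vecLoop (m := m) (Y := Y) hV rfl hmss hYss acc
  rw [lS, vecAt, if_neg (lt_irrefl _), succD_self, Function.update_idem, ← hNA, ← mS_vS, ← mS_vS] at h5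
  set acc' := (accW cap len (maskOf bs) F n t ss (odoM ss)).reverse ++ acc with hacc'
  -- 6. clean-up
  set S5 := mS (vS acc' T) NA D (wAC P F) (dW ss) (wBT (btab P F)) (dW (List.replicate ss.length 0)) with hS5
  have h6 := runs_clear (kr KR.dict) S5
  rw [hS5, mS_dict, update_mS_dict] at h6
  have h7 := runs_clear (kr KR.na) (mS (vS acc' T) NA [] (wAC P F) (dW ss) (wBT (btab P F)) (dW (List.replicate ss.length 0)))
  rw [mS_na, update_mS_na] at h7
  have h8 := runs_clear (kr KR.ac) (mS (vS acc' T) [] [] (wAC P F) (dW ss) (wBT (btab P F)) (dW (List.replicate ss.length 0)))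
  rw [mS_ac, update_mS_ac] at h8
  have h9 := runs_clear (kr KR.bt) (mS (vS acc' T) [] [] [] (dW ss) (wBT (btab P F)) (dW (List.replicate ss.length 0)))
  rw [mS_bt, update_mS_bt] at h9
  have h10 := runs_clear (kr KR.szs) (mS (vS acc' T) [] [] [] (dW ss) [] (dW (List.replicate ss.length 0)))
  rw [mS_szs, update_mS_szs] at h10
  have h11 := runs_clear (kr KR.fv) (mS (vS acc' T) [] [] [] [] [] (dW (List.replicate ss.length 0)))
  rw [mS_fv, update_mS_fv] at h11
  refine (h1.seq (h2.seq (h3.seq (h4.seq (h5.seq (h6.seq (h7.seq (h8.seq (h9.seq (h10.seq h11)))))))))).of_eq (hM.mS_vS0 acc') ?_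
  rw [dW_replicate_zero, List.length_replicate]
  unfold maskCost
  rw [← hss, ← hP, ← hm, ← hD, ← hNA]
  omega

end MaskSpec

end Literature.Computability.FineGrained.IPRenameM
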